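import Summits.HodgeConjecture.HodgeConjecture.Theorems.NikulinTwinTransportHodgeIsometryAlgebraicGysinBaseChange
import Literature.AlgebraicGeometry.HodgeTheory.ComplexGysinHodgeType

/-!
# Route NikulinTwinTransport · item `SquareHodgeOfSqrtTwo` (stmt-HodgeConjecture-13680) —
# Künneth normal forms and fibre integration on the square `S ⊗ S` of a surface, from the
# Künneth spanning property

The sector item `SquareHodgeOfSqrtTwo` (the Hodge conjecture for `S ⊗ S`, `S` a projective K3
surface with `End_Hdg(T(S)_ℚ) = ℚ + ℚ·e`, `e² = 2`) closes in the route through the glue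
`SquareGlue : RealMultiplicationSqrtTwoAlgebraic → LefschetzOneOneK3 → SquareHodgeOfSqrtTwo`, whose
content is the Künneth bookkeeping of the Hodge classes of `S × S` (Varesco 2023, p. 8: "proving the
Hodge conjecture for `X²` is equivalent to showing that every element of `End_Hdg(T(X))` is
algebraic"). This file is the TOPOLOGICAL half of that bookkeeping on the tree's carriers
(`complexBetti`, `cupProduct`, `complexBetti.map (fst S S)`, `complexGysin`), from ONE input, the
spanning half of the Künneth formula over `ℂ` (Hatcher, *Algebraic Topology*, Thm. 3.15 / 3.16:
every class on `(Y ⊗ Z)(ℂ)` is a `ℂ`-linear combination of cross products `fst^* b ∪ snd^* w`) — the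
hypothesis `hK` of the sibling file `…HodgeIsometryAlgebraicGysinBaseChange` (seat 0), kept in the
SAME universal shape so that one Künneth theorem discharges both:

* `complexBetti_three_eq_zero` — `H³(S(ℂ); ℂ) = 0` for a smooth projective surface with `b₁ = 0`
  (the cup pairing `H³ × H¹ → H⁴ → ℂ` is perfect over `ℂ`, Hatcher Prop. 3.38, PROVED in the tree);
* `exists_fst_gysin_snd_ne_zero`, `exists_fibreIntegral_of_kunneth` — **fibre integration**
  `fst_*(snd^* w) = c • 1` with `c ≠ 0` for a non-zero top class `w` (Fulton, *Young Tableaux*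
  App. B (4): base change for the square `X × Z → Z → pt`), from `hK` in the top degree of
  `X ⊗ Z`: the hypothesis (FI) of `realMultiplicationSqrtTwoAlgebraic_of_fibreIntegral` (item 13679)
  is thereby DISCHARGED from `hK` (`fibreIntegral_square_of_kunneth`; the corollaries for items
  13679/13681 are drawn in the sibling file `…RealMultiplicationOfKunneth`);
* `cross_top_ne_zero` — `fst^* p ∪ snd^* p ≠ 0` on `(S ⊗ S)(ℂ)` for the generator `p` of `H⁴(S(ℂ))`;
* `kunneth_two`, `kunneth_four`, `kunneth_six` — the **Künneth normal forms** of the classes of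
  degrees `2, 4, 6` on `(S ⊗ S)(ℂ)` for a surface with `b₁ = 0` (`H⁰ = ℂ·1`, `H¹ = H³ = 0`,
  `H⁴ = ℂ·p`, `H^{>4} = 0`): `a ⊠ 1 + 1 ⊠ b`, `Σᵢ vᵢ ⊠ uᵢ + t₄ • 1 ⊠ p + t₀ • p ⊠ 1` (for a basis
  `(vᵢ)` of `H²(S(ℂ); ℂ)`), `a ⊠ p + p ⊠ b` (Hatcher Thm. 3.16; Huybrechts, *Lectures on K3
  surfaces*, Ch. 1 §3.2 for the Betti profile of a K3 surface).

## References

* [HatcherAT2002] A. Hatcher, Algebraic Topology, CUP 2002, §3.2 Thm. 3.15–3.16, §3.3 Prop. 3.38.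
* [FultonYoungTableaux1997] W. Fulton, Young Tableaux, CUP 1997, Appendix B §B.1 (3)–(6).
* [Huybrechts2016K3] D. Huybrechts, Lectures on K3 Surfaces, CUP 2016, Ch. 1 §3.2.
* [Varesco2023] M. Varesco, Hodge similitudes and the Hodge conjecture for squares of K3 surfaces
  (2023), §2 (p. 8).
-/

noncomputable section

open CategoryTheory AlgebraicGeometry MonoidalCategory CartesianMonoidalCategory
open Literature.AlgebraicGeometry.Motives Literature.AlgebraicGeometry.HodgeTheory
open Literature.AlgebraicTopology.SingularHomology

namespace Summit.HodgeConjecture.HodgeConjecture.Theorems.NikulinTwinTransport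

variable {l n : ℕ} {S X Z : SchemeOver ℂ}

/-! ### `H³ = 0` for a surface with `b₁ = 0` -/

/-- **`H³(S(ℂ); ℂ) = 0` for a smooth projective surface with `H¹(S(ℂ); ℂ) = 0`**: the cup product
pairing `H³ × H¹ → H⁴ → ℂ` of the closed oriented `4`-manifold `S(ℂ)` is perfect over `ℂ`
(`eq_zero_of_forall_cupPairing_eq_zero`, Hatcher Prop. 3.38), and its second argument ranges over
`H¹ = 0`. [cite: HatcherAT2002, §3.3 Prop. 3.38] [cite: Huybrechts2016K3, Ch. 1 §3.2] -/
theorem complexBetti_three_eq_zero (μ : OrientationFamily) (hS : IsSmoothProjective 2 S)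
    [Subsingleton (complexBetti S 1)] (a : complexBetti S 3) : a = 0 :=
  eq_zero_of_forall_cupPairing_eq_zero μ hS (show 3 + 1 = 2 * 2 by norm_num) fun b ↦ by
    rw [Subsingleton.elim b 0, map_zero]

/-! ### Fibre integration from the Künneth spanning property -/

/-- **For some top class `w ∈ H²ⁿ(Z(ℂ))`, `fst_*(snd^* w) ≠ 0` in `H⁰(X(ℂ))`**, GRANTED the Künneth
spanning property in the top degree of `X ⊗ Z`: some top-degree class of `(X ⊗ Z)(ℂ)` pairs
non-trivially with the fundamental class (universal coefficients over `ℂ`, `[·] ≠ 0`), hence so does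
some cross product `fst^* a ∪ snd^* w`, necessarily with `a`, `w` of top degree, and
`⟨fst^* a ∪ snd^* w, [X ⊗ Z]⟩ = ⟨fst^* a, snd^* w ⌢ [X ⊗ Z]⟩ = ⟨a, fst_*(snd^* w) ⌢ [X]⟩` (the defining
square of the Gysin morphism). The two-factor case of
`exists_complexGysin_map_ne_zero`. [cite: HatcherAT2002, §3.2 Thm. 3.15 and §3.1 Thm. 3.2]
[cite: FultonYoungTableaux1997, Appendix B §B.1 (5)] -/
theorem exists_fst_gysin_snd_ne_zero (μ : OrientationFamily)
    (hX : IsSmoothProjective l X) (hZ : IsSmoothProjective n Z)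
    (hKT : ∀ z : complexBetti (X ⊗ Z) (2 * (l + n)), z ∈ Submodule.span ℂ
      {v | ∃ (i j : ℕ) (h : i + j = 2 * (l + n)) (a : complexBetti X i) (w : complexBetti Z j),
        v = cupProduct h (complexBetti.map (fst X Z) i a) (complexBetti.map (snd X Z) j w)}) :
    ∃ w : complexBetti Z (2 * n),
      complexGysin μ (IsSmoothProjective.tensor_holds hX hZ) hX (fst X Z)
        (show 2 * n + 2 * l = 0 + 2 * (l + n) by omega)
        (complexBetti.map (snd X Z) (2 * n) w) ≠ 0 := by
  have hμ : μ.HasPoincareDuality := OrientationFamily.hasPoincareDuality μ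
  have hT := IsSmoothProjective.tensor_holds hX hZ
  letI := hT.chartedSpace
  haveI := ComplexPoints.compactSpace_of_isSmoothProjective hT
  haveI := ComplexPoints.t2Space_of_isSmoothProjective hT
  haveI := connectedSpace_complexPoints hT
  set κ := kroneckerPairing ℂ ℂ (ComplexPoints (X ⊗ Z)) (2 * (l + n)) with hκ
  have hne : (μ hT).fundamentalClass ≠ 0 := fundamentalClass_ne_zero (μ hT)
  obtain ⟨φ, hφ⟩ : ∃ φ : Module.Dual ℂ (singularHomology ℂ ℂ (ComplexPoints (X ⊗ Z)) (2 * (l + n))),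
      φ (μ hT).fundamentalClass ≠ 0 := by
    by_contra h
    push Not at h
    exact hne ((Module.forall_dual_apply_eq_zero_iff ℂ _).1 h)
  obtain ⟨G₀, hG₀⟩ := kroneckerPairing_surjective ℂ (ComplexPoints (X ⊗ Z)) (2 * (l + n)) φ
  have hG₀ne : κ G₀ (μ hT).fundamentalClass ≠ 0 := by rw [hκ, hG₀]; exact hφ
  by_contra hall
  push Not at hall
  apply hG₀ne
  -- the pairing with `[X ⊗ Z]` kills every cross product `fst^* a ∪ snd^* w`, `a`, `w` of top degree
  have key : ∀ (a : complexBetti X (2 * l)) (w : complexBetti Z (2 * n)),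
      κ (cupProduct (show 2 * l + 2 * n = 2 * (l + n) by omega)
        (complexBetti.map (fst X Z) (2 * l) a) (complexBetti.map (snd X Z) (2 * n) w))
        (μ hT).fundamentalClass = 0 := by
    intro a w
    have hsign : ((-1 : ℂ) ^ (2 * l * (2 * n))) = 1 := Even.neg_one_pow ⟨l * (2 * n), by ring⟩
    rw [cupProduct_gradedComm_holds ℂ _ _ (show 2 * n + 2 * l = 2 * (l + n) by omega), hsign,
      one_smul, hκ, kroneckerPairing_cupProduct]
    change kroneckerPairing ℂ ℂ _ _ (singularCohomology.map ℂ ℂ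
      (AlgPoints.mapContinuous (L := ℂ) (fst X Z)) _ a) _ = 0
    rw [kroneckerPairing_map, ← capProduct_complexGysin hμ hT hX (fst X Z)
      (show 2 * n + 2 * l = 0 + 2 * (l + n) by omega) _ (Nat.zero_add _), hall w,
      map_zero, LinearMap.zero_apply, map_zero]
  have hle : Submodule.span ℂ {v | ∃ (i j : ℕ) (h : i + j = 2 * (l + n)) (a : complexBetti X i)
        (w : complexBetti Z j),
        v = cupProduct h (complexBetti.map (fst X Z) i a) (complexBetti.map (snd X Z) j w)} ≤
      LinearMap.ker (κ.flip (μ hT).fundamentalClass) := by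
    refine Submodule.span_le.2 ?_
    rintro _ ⟨i, j, h, a, w, rfl⟩
    rw [SetLike.mem_coe, LinearMap.mem_ker, LinearMap.flip_apply]
    rcases lt_trichotomy (2 * l) i with hi | hi | hi
    · haveI := subsingleton_complexBetti hX hi
      rw [Subsingleton.elim a 0, map_zero, map_zero, LinearMap.zero_apply, map_zero,
        LinearMap.zero_apply]
    swap
    · haveI := subsingleton_complexBetti hZ (show 2 * n < j by omega)
      rw [Subsingleton.elim w 0, map_zero, map_zero, map_zero, LinearMap.zero_apply]
    subst hi
    obtain rfl : j = 2 * n := by omega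
    exact key a w
  exact hle (hKT G₀)

/-- **Fibre integration from the Künneth spanning property**: for `X`, `Z` smooth projective
(dimensions `l`, `n`) and a non-zero top class `w₁ ∈ H²ⁿ(Z(ℂ); ℂ)` there is `c ≠ 0` with
`fst_*(snd^* w₁) = c • 1` in `H⁰(X(ℂ); ℂ)` — `H⁰(X(ℂ)) = ℂ · 1` (`exists_eq_smul_one`), `H²ⁿ(Z(ℂ))` is
the line `ℂ · w₁` (`exists_eq_smul_of_top`), and `fst_* snd^*` does not vanish on it
(`exists_fst_gysin_snd_ne_zero`). For the complex orientations `c = deg w₁`; the tree fixes no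
normalisation of its orientation families, whence the unspecified non-zero scalar (Fulton,
*Young Tableaux*, App. B (4): `g^* f_* = f'_* g'^*` for the fibre square over a point).
[cite: FultonYoungTableaux1997, Appendix B §B.1 (4)–(5)] [cite: HatcherAT2002, §3.2 Thm. 3.15] -/
theorem exists_fibreIntegral_of_kunneth (μ : OrientationFamily)
    (hX : IsSmoothProjective l X) (hZ : IsSmoothProjective n Z)
    (hKT : ∀ z : complexBetti (X ⊗ Z) (2 * (l + n)), z ∈ Submodule.span ℂ
      {v | ∃ (i j : ℕ) (h : i + j = 2 * (l + n)) (a : complexBetti X i) (w : complexBetti Z j),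
        v = cupProduct h (complexBetti.map (fst X Z) i a) (complexBetti.map (snd X Z) j w)})
    {w₁ : complexBetti Z (2 * n)} (hw₁ : w₁ ≠ 0) :
    ∃ c : ℂ, c ≠ 0 ∧
      complexGysin μ (IsSmoothProjective.tensor_holds hX hZ) hX (fst X Z)
        (show 2 * n + 2 * l = 0 + 2 * (l + n) by omega)
        (complexBetti.map (snd X Z) (2 * n) w₁) = c • singularCohomology.one ℂ (ComplexPoints X) := by
  obtain ⟨c, hc⟩ := exists_eq_smul_one μ hX
    (complexGysin μ (IsSmoothProjective.tensor_holds hX hZ) hX (fst X Z)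
      (show 2 * n + 2 * l = 0 + 2 * (l + n) by omega) (complexBetti.map (snd X Z) (2 * n) w₁))
  refine ⟨c, ?_, hc⟩
  rintro rfl
  rw [zero_smul] at hc
  obtain ⟨w, hw⟩ := exists_fst_gysin_snd_ne_zero μ hX hZ hKT
  obtain ⟨t, rfl⟩ := exists_eq_smul_of_top μ hZ hw₁ w
  exact hw (by rw [map_smul, map_smul, hc, smul_zero])

/-! ### The square `S ⊗ S` of a surface: fibre integration and `p ⊠ p ≠ 0` -/

/-- **Fibre integration on the square of a surface**: for `S` a smooth projective surface and a
non-zero `p ∈ H⁴(S(ℂ); ℂ)`, `fst_*(snd^* p) = c • 1_S` with `c ≠ 0`, GRANTED the Künneth spanning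
property in degree `8` of `(S ⊗ S)(ℂ)` — EXACTLY the shape of hypothesis (FI) of
`realMultiplicationSqrtTwoAlgebraic_of_fibreIntegral`. [cite: FultonYoungTableaux1997, Appendix B §B.1 (4)]
[cite: HatcherAT2002, §3.2 Thm. 3.15] -/
theorem fibreIntegral_square_of_kunneth (μ : OrientationFamily) (hS : IsSmoothProjective 2 S)
    (hK8 : ∀ z : complexBetti (S ⊗ S) (2 * (2 + 2)), z ∈ Submodule.span ℂ
      {v | ∃ (i j : ℕ) (h : i + j = 2 * (2 + 2)) (a : complexBetti S i) (w : complexBetti S j),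
        v = cupProduct h (complexBetti.map (fst S S) i a) (complexBetti.map (snd S S) j w)})
    {p : complexBetti S (2 * 2)} (hp : p ≠ 0) :
    ∃ c : ℂ, c ≠ 0 ∧
      complexGysin μ (IsSmoothProjective.tensor_holds hS hS) hS (fst S S)
        (rfl : 2 * 2 + 2 * 2 = 0 + 2 * (2 + 2)) (complexBetti.map (snd S S) (2 * 2) p) =
      c • singularCohomology.one ℂ (ComplexPoints S) :=
  exists_fibreIntegral_of_kunneth μ hS hS hK8 hp

/-- **`p ⊠ p = fst^* p ∪ snd^* p ≠ 0` in `H⁸((S ⊗ S)(ℂ); ℂ)`** for a non-zero top class `p` of the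
surface `S`: by the projection formula `fst_*(fst^* p ∪ snd^* p) = p ∪ fst_*(snd^* p) = c • p`
with `c ≠ 0` (`fibreIntegral_square_of_kunneth`). [cite: FultonYoungTableaux1997, Appendix B §B.1 (4) and (6)] -/
theorem cross_top_ne_zero (μ : OrientationFamily) (hS : IsSmoothProjective 2 S)
    (hK8 : ∀ z : complexBetti (S ⊗ S) (2 * (2 + 2)), z ∈ Submodule.span ℂ
      {v | ∃ (i j : ℕ) (h : i + j = 2 * (2 + 2)) (a : complexBetti S i) (w : complexBetti S j),
        v = cupProduct h (complexBetti.map (fst S S) i a) (complexBetti.map (snd S S) j w)})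
    {p : complexBetti S (2 * 2)} (hp : p ≠ 0) :
    cupProduct (rfl : 2 * 2 + 2 * 2 = 2 * 4) (complexBetti.map (fst S S) (2 * 2) p)
      (complexBetti.map (snd S S) (2 * 2) p) ≠ 0 := by
  have hμ : μ.HasPoincareDuality := OrientationFamily.hasPoincareDuality μ
  obtain ⟨c, hc, hFI⟩ := fibreIntegral_square_of_kunneth μ hS hK8 hp
  intro h0
  have h1 := complexGysin_cup hμ (IsSmoothProjective.tensor_holds hS hS) hS (fst S S)
    (rfl : 2 * 2 + 2 * 2 = 2 * 4) (rfl : 2 * 4 + 2 * 2 = 2 * 2 + 2 * (2 + 2))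
    (rfl : 2 * 2 + 2 * 2 = 0 + 2 * (2 + 2)) (rfl : 2 * 2 + 0 = 2 * 2) p
    (complexBetti.map (snd S S) (2 * 2) p)
  rw [h0, map_zero, hFI, map_smul, cupProduct_one] at h1
  exact hp ((smul_eq_zero.1 h1.symm).resolve_left hc)

/-! ### Künneth normal forms on `(S ⊗ S)(ℂ)` in degrees `2`, `4`, `6` -/

section NormalForms

variable (μ : OrientationFamily) (hS : IsSmoothProjective 2 S) [Subsingleton (complexBetti S 1)]
  (hKS : ∀ (k : ℕ) (z : complexBetti (S ⊗ S) k), z ∈ Submodule.span ℂ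
    {v | ∃ (i j : ℕ) (h : i + j = k) (a : complexBetti S i) (w : complexBetti S j),
      v = cupProduct h (complexBetti.map (fst S S) i a) (complexBetti.map (snd S S) j w)})

include μ hS hKS

/-- **Künneth normal form in degree `2`**: on the square of a smooth projective surface with
`b₁ = 0`, every class of `H²((S ⊗ S)(ℂ); ℂ)` is `fst^* a + snd^* b` (`H²(S × S) = H² ⊗ H⁰ ⊕ H⁰ ⊗ H²`,
`H⁰ = ℂ · 1`, `H¹ = 0`). [cite: HatcherAT2002, §3.2 Thm. 3.16] [cite: Huybrechts2016K3, Ch. 1 §3.2] -/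
theorem kunneth_two (z : complexBetti (S ⊗ S) (2 * 1)) :
    ∃ a b : complexBetti S (2 * 1),
      z = complexBetti.map (fst S S) (2 * 1) a + complexBetti.map (snd S S) (2 * 1) b := by
  -- the normal forms make up the submodule `W = range fst^* ⊔ range snd^*`
  let W : Submodule ℂ (complexBetti (S ⊗ S) (2 * 1)) :=
    LinearMap.range (complexBetti.map (fst S S) (2 * 1)).hom ⊔
      LinearMap.range (complexBetti.map (snd S S) (2 * 1)).hom
  suffices hW : z ∈ W by
    obtain ⟨_, ⟨a, rfl⟩, _, ⟨b, rfl⟩, hab⟩ := Submodule.mem_sup.1 hW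
    exact ⟨a, b, hab.symm⟩
  refine (Submodule.span_le.2 ?_) (hKS (2 * 1) z)
  rintro _ ⟨i, j, h, a, w, rfl⟩
  have hi : i ≤ 2 := by omega
  interval_cases i
  · -- `i = 0`: `a = t • 1`, `fst^* 1 ∪ snd^* w = snd^* w`
    obtain rfl : j = 2 * 1 := by omega
    obtain ⟨t, rfl⟩ := exists_eq_smul_one μ hS a
    refine Submodule.mem_sup_right ⟨t • w, ?_⟩
    simp only [map_smul, LinearMap.smul_apply]
    rw [singularCohomology.map_one, one_cupProduct]
  · -- `i = 1`: `a = 0`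
    rw [Subsingleton.elim a 0, map_zero, map_zero, LinearMap.zero_apply]
    exact W.zero_mem
  · -- `i = 2`: `w = t • 1`, `fst^* a ∪ snd^* 1 = fst^* a`
    obtain rfl : j = 0 := by omega
    obtain ⟨t, rfl⟩ := exists_eq_smul_one μ hS w
    refine Submodule.mem_sup_left ⟨t • a, ?_⟩
    simp only [map_smul]
    rw [singularCohomology.map_one, cupProduct_one]

/-- **Künneth normal form in degree `6`**: on the square of a smooth projective surface with
`b₁ = 0` (hence `b₃ = 0`) and `p ≠ 0` in `H⁴(S(ℂ); ℂ) = ℂ · p`, every class of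
`H⁶((S ⊗ S)(ℂ); ℂ)` is `fst^* a ∪ snd^* p + fst^* p ∪ snd^* b` (`H⁶(S × S) = H² ⊗ H⁴ ⊕ H⁴ ⊗ H²`).
[cite: HatcherAT2002, §3.2 Thm. 3.16] [cite: Huybrechts2016K3, Ch. 1 §3.2] -/
theorem kunneth_six {p : complexBetti S (2 * 2)} (hp : p ≠ 0) (z : complexBetti (S ⊗ S) (2 * 3)) :
    ∃ a b : complexBetti S (2 * 1),
      z = cupProduct (rfl : 2 * 1 + 2 * 2 = 2 * 3) (complexBetti.map (fst S S) (2 * 1) a)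
            (complexBetti.map (snd S S) (2 * 2) p) +
          cupProduct (rfl : 2 * 2 + 2 * 1 = 2 * 3) (complexBetti.map (fst S S) (2 * 2) p)
            (complexBetti.map (snd S S) (2 * 1) b) := by
  -- the two linear maps `a ↦ fst^* a ∪ snd^* p`, `b ↦ fst^* p ∪ snd^* b` and `W` the sum of their ranges
  let L : complexBetti S (2 * 1) →ₗ[ℂ] complexBetti (S ⊗ S) (2 * 3) :=
    (cupProduct (rfl : 2 * 1 + 2 * 2 = 2 * 3)).flip (complexBetti.map (snd S S) (2 * 2) p) ∘ₗ
      (complexBetti.map (fst S S) (2 * 1)).hom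
  let L' : complexBetti S (2 * 1) →ₗ[ℂ] complexBetti (S ⊗ S) (2 * 3) :=
    cupProduct (rfl : 2 * 2 + 2 * 1 = 2 * 3) (complexBetti.map (fst S S) (2 * 2) p) ∘ₗ
      (complexBetti.map (snd S S) (2 * 1)).hom
  let W : Submodule ℂ (complexBetti (S ⊗ S) (2 * 3)) := LinearMap.range L ⊔ LinearMap.range L'
  suffices hW : z ∈ W by
    obtain ⟨_, ⟨a, rfl⟩, _, ⟨b, rfl⟩, hab⟩ := Submodule.mem_sup.1 hW
    exact ⟨a, b, hab.symm⟩
  refine (Submodule.span_le.2 ?_) (hKS (2 * 3) z)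
  rintro _ ⟨i, j, h, a, w, rfl⟩
  rcases le_or_gt i 4 with hi | hi
  swap
  · haveI := subsingleton_complexBetti hS (show 2 * 2 < i by omega)
    rw [Subsingleton.elim a 0, map_zero, map_zero, LinearMap.zero_apply]
    exact W.zero_mem
  interval_cases i
  · -- `i = 0`: `w ∈ H⁶(S(ℂ)) = 0`
    haveI := subsingleton_complexBetti hS (show 2 * 2 < j by omega)
    rw [Subsingleton.elim w 0, map_zero, map_zero]
    exact W.zero_mem
  · rw [Subsingleton.elim a 0, map_zero, map_zero, LinearMap.zero_apply]
    exact W.zero_mem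
  · -- `i = 2`: `w = s • p`
    obtain rfl : j = 2 * 2 := by omega
    obtain ⟨s, rfl⟩ := exists_eq_smul_of_top μ hS hp w
    refine Submodule.mem_sup_left ⟨s • a, ?_⟩
    simp only [L, map_smul, LinearMap.comp_apply, LinearMap.flip_apply]
  · rw [complexBetti_three_eq_zero μ hS a, map_zero, map_zero, LinearMap.zero_apply]
    exact W.zero_mem
  · -- `i = 4`: `a = s • p`
    obtain rfl : j = 2 * 1 := by omega
    obtain ⟨s, rfl⟩ := exists_eq_smul_of_top μ hS hp a
    refine Submodule.mem_sup_right ⟨s • w, ?_⟩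
    simp only [L', map_smul, LinearMap.smul_apply, LinearMap.comp_apply]

/-- **Künneth normal form in degree `4`**: on the square of a smooth projective surface with
`b₁ = 0` (hence `b₃ = 0`), `p ≠ 0` in `H⁴(S(ℂ); ℂ) = ℂ · p` and a basis `(vᵢ)` of `H²(S(ℂ); ℂ)`,
every class of `H⁴((S ⊗ S)(ℂ); ℂ)` is `Σᵢ fst^* vᵢ ∪ snd^* uᵢ + t₄ • snd^* p + t₀ • fst^* p`
(`H⁴(S × S) = H⁰ ⊗ H⁴ ⊕ H² ⊗ H² ⊕ H⁴ ⊗ H⁰`; Huybrechts Ch. 1 §3.2: `b₀ = b₄ = 1`, `b₁ = b₃ = 0`,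
`b₂ = 22` for a K3 surface). [cite: HatcherAT2002, §3.2 Thm. 3.16] [cite: Huybrechts2016K3, Ch. 1 §3.2] -/
theorem kunneth_four {p : complexBetti S (2 * 2)} (hp : p ≠ 0) {ι : Type} [Fintype ι] [DecidableEq ι]
    (v : Module.Basis ι ℂ (complexBetti S (2 * 1))) (z : complexBetti (S ⊗ S) (2 * 2)) :
    ∃ (u : ι → complexBetti S (2 * 1)) (t₄ t₀ : ℂ),
      z = (∑ i, cupProduct (rfl : 2 * 1 + 2 * 1 = 2 * 2) (complexBetti.map (fst S S) (2 * 1) (v i))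
              (complexBetti.map (snd S S) (2 * 1) (u i))) +
          t₄ • complexBetti.map (snd S S) (2 * 2) p + t₀ • complexBetti.map (fst S S) (2 * 2) p := by
  -- `Φ u = Σᵢ fst^* vᵢ ∪ snd^* uᵢ` and `W = range Φ ⊔ ℂ · snd^* p ⊔ ℂ · fst^* p`
  let Φ : (ι → complexBetti S (2 * 1)) →ₗ[ℂ] complexBetti (S ⊗ S) (2 * 2) :=
    ∑ i, cupProduct (rfl : 2 * 1 + 2 * 1 = 2 * 2) (complexBetti.map (fst S S) (2 * 1) (v i)) ∘ₗ
      (complexBetti.map (snd S S) (2 * 1)).hom ∘ₗ LinearMap.proj i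
  have hΦ : ∀ u, Φ u = ∑ i, cupProduct (rfl : 2 * 1 + 2 * 1 = 2 * 2)
      (complexBetti.map (fst S S) (2 * 1) (v i)) (complexBetti.map (snd S S) (2 * 1) (u i)) := fun u ↦ by
    simp only [Φ, LinearMap.coe_sum, Finset.sum_apply, LinearMap.comp_apply, LinearMap.proj_apply]
  let W : Submodule ℂ (complexBetti (S ⊗ S) (2 * 2)) :=
    (LinearMap.range Φ ⊔ Submodule.span ℂ {complexBetti.map (snd S S) (2 * 2) p}) ⊔
      Submodule.span ℂ {complexBetti.map (fst S S) (2 * 2) p}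
  suffices hW : z ∈ W by
    obtain ⟨_, h₁, _, h₀, hz⟩ := Submodule.mem_sup.1 hW
    obtain ⟨_, ⟨u, rfl⟩, _, h₄, hy⟩ := Submodule.mem_sup.1 h₁
    obtain ⟨t₄, rfl⟩ := Submodule.mem_span_singleton.1 h₄
    obtain ⟨t₀, rfl⟩ := Submodule.mem_span_singleton.1 h₀
    exact ⟨u, t₄, t₀, by rw [← hz, ← hy, hΦ]⟩
  refine (Submodule.span_le.2 ?_) (hKS (2 * 2) z)
  rintro _ ⟨i, j, h, a, w, rfl⟩
  have hi : i ≤ 4 := by omega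
  interval_cases i
  · -- `i = 0`: `a = t • 1`, `w = s • p`: `t s • snd^* p`
    obtain rfl : j = 2 * 2 := by omega
    obtain ⟨t, rfl⟩ := exists_eq_smul_one μ hS a
    obtain ⟨s, rfl⟩ := exists_eq_smul_of_top μ hS hp w
    refine Submodule.mem_sup_left (Submodule.mem_sup_right ?_)
    simp only [map_smul, LinearMap.smul_apply]
    rw [singularCohomology.map_one, one_cupProduct]
    exact Submodule.smul_mem _ _ (Submodule.smul_mem _ _ (Submodule.mem_span_singleton_self _))
  · rw [Subsingleton.elim a 0, map_zero, map_zero, LinearMap.zero_apply]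
    exact W.zero_mem
  · -- `i = 2`: `fst^* a ∪ snd^* w = Φ (i ↦ (v.repr a i) • w)` by expanding `a` in the basis
    obtain rfl : j = 2 := by omega
    refine Submodule.mem_sup_left (Submodule.mem_sup_left ?_)
    -- `a ↦ fst^* a ∪ snd^* w` maps every basis vector into `range Φ`
    let Lw : complexBetti S (2 * 1) →ₗ[ℂ] complexBetti (S ⊗ S) (2 * 2) :=
      (cupProduct h).flip (complexBetti.map (snd S S) 2 w) ∘ₗ (complexBetti.map (fst S S) 2).hom
    have key : Submodule.span ℂ (Set.range v) ≤ (LinearMap.range Φ).comap Lw := by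
      refine Submodule.span_le.2 ?_
      rintro _ ⟨i, rfl⟩
      refine ⟨Pi.single i w, ?_⟩
      rw [hΦ, Finset.sum_eq_single i (fun j _ hji ↦ by rw [Pi.single_eq_of_ne hji, map_zero, map_zero])
        (fun hi ↦ (hi (Finset.mem_univ i)).elim), Pi.single_eq_same]
      rfl
    rw [v.span_eq] at key
    exact key (Submodule.mem_top (x := a))
  · rw [complexBetti_three_eq_zero μ hS a, map_zero, map_zero, LinearMap.zero_apply]
    exact W.zero_mem
  · -- `i = 4`: `a = s • p`, `w = t • 1`: `s t • fst^* p`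
    obtain rfl : j = 0 := by omega
    obtain ⟨s, rfl⟩ := exists_eq_smul_of_top μ hS hp a
    obtain ⟨t, rfl⟩ := exists_eq_smul_one μ hS w
    refine Submodule.mem_sup_right ?_
    simp only [map_smul, LinearMap.smul_apply]
    rw [singularCohomology.map_one, cupProduct_one]
    exact Submodule.smul_mem _ _ (Submodule.smul_mem _ _ (Submodule.mem_span_singleton_self _))

end NormalForms

end Summit.HodgeConjecture.HodgeConjecture.Theorems.NikulinTwinTransport

end
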